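import Literature.AlgebraicGeometry.ModuliOfAbelianVarieties.RelativeExponentialChartLevelReadings      -- ★ FLAT-b(i) head (setting, plumbing)
import Literature.AlgebraicGeometry.AbelianSchemes.TorsionSectionPairingUnitsFibrewise                  -- ★ W2 `exists_pairingUnits_weilPairingLevel_eq_inv`
import Literature.AlgebraicGeometry.Motives.ComplexPointsRootOfUnityLocallyConstant                     -- ★ W3 `AlgPoints.eventually_nhdsWithin_appTop_comp_eq_of_pow_eq_one`
import Literature.AlgebraicGeometry.FundamentalGroup.RiemannExistenceEtaleLocalHomeomorph              -- ★ `exists_openPartialHomeomorph_eqOn_map_of_etale`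
import Literature.AlgebraicGeometry.AbelianSchemes.LevelBasisFiniteEtaleCoverSurjective                 -- ★ `exists_finite_etale_surjective_levelStructure`
import Literature.AlgebraicGeometry.AbelianSchemes.LevelStructureTorsionPointsBasis                     -- ★ `LevelStructure.exists_restrictPt_section_eq`
import Literature.AlgebraicGeometry.AbelianSchemes.AbelianSchemeFibreEndomorphismOfBaseChange           -- ★ `fibrePointToLeft_map_fibreBaseChangeIso_hom`
import Literature.AlgebraicGeometry.AbelianSchemes.AbelianSchemeIsLambdaOfAtConjugate                   -- ★ `IsLambdaOfAt.weilPairingLevel_eq`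
import Literature.AlgebraicGeometry.AbelianSchemes.AbelianSchemeOverHomNoetherianAnyBase                -- ★ `isCommMonObj_of_isLocallyNoetherian_base`
import Literature.AlgebraicGeometry.AbelianSchemes.SymplecticLiftableOfOnePoint                         -- ★ `isUnit_natCast_appTop_of_forall_residueField`
import Literature.AlgebraicGeometry.Morphisms.FiniteEtaleSurjectiveLift                                 -- ★ `exists_specOver_of_surjective`
import Literature.AlgebraicGeometry.Resolution.SmoothStalksRegular                                      -- ★ `isReduced_of_smooth`
import HarnessLib

/-!
# The WEIL-PAIRING READINGS of an analytified polarised abelian scheme are CONSTANT along a relative exponential chart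
# ([MumfordAV1970] §20: the `e_n`-pairing over a base is a section of the finite étale `μ_n`; [BirkenhakeLange2004] §8.7 Lemma 8.7.1;
# [DeligneHodgeII1971] §4.4 (4.4.2)–(4.4.3): the polarisation is a morphism of local systems `R₁f_*ℤ ⊗ R₁f_*ℤ → ℤ(1)`)

Layer `Literature/AlgebraicGeometry/ModuliOfAbelianVarieties`, namespace
`Literature.AlgebraicGeometry.ModuliOfAbelianVarieties.RelativeExponentialChartPairingReadings`.  THEOREMS ONLY (no definition, no named fact,
no instance, no notation, no `sorry`).  Cell `hodgecm-mathlib` (D-0151), FLOOR 0, P6 «MOD» (crux hLiu418 = stmt-HodgeConjecture-24832, `--supports`),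
half A line L7, socket `stub_UNIVFAM` (★ P-3), organ O3 `stub_FLAT`, sub-organ **FLAT-b(ii) «PAIRING READINGS CONSTANT ALONG A CHART»**, LOCAL
HEAD (LA7-plan RULING 2026-09-02T02:22Z (3)–(4), route (α); interface LA7-p01 (g0) v1 (W=)).  HC_CM is proved only modulo the printed citations
until rung 0 closes; this file is count-neutral.

THE MATHEMATICS (route (α)).  Let `P = (A, λ, level)` be a polarised abelian scheme over a smooth complex base `T`, `φT`, `φA` analytifications,
`(Φ₁, ex₁)` a relative exponential chart of `A^an → T^an` over `V` with additive fibre analytifications (G), and `s₁ ∈ V`.  For `M ≥ 1` take a finite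
étale surjective `b : B → T` with a level-`M` structure on `A_B` ([MumfordFogartyKirwan1994] Prop. 7.3 step (IV) ∕ [GortzWedhorn2023] Prop.
27.188; ★ `exists_finite_etale_surjective_levelStructure`): every `M`-torsion point of a fibre is the value of an `M`-torsion SECTION of `A_B`,
and the Weil pairing of two such sections is the fibre value of ONE global unit `u ∈ μ_M(Γ(B, 𝒪_B))` ([MumfordAV1970] §20; ★ W2
`exists_pairingUnits_weilPairingLevel_eq_inv`).  The map `B(ℂ) → T(ℂ)` is a local homeomorphism (★ `exists_openPartialHomeomorph_eqOn_map_of_etale`),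
so near `s₁` there is a continuous local section `τ`; along it each torsion section of `A_B` is a CONTINUOUS section of `A^an → T^an` with
`M`-division chart readings, hence KEEPS its chart reading (★ W1 `IsRelExpChartOn.eventually_sectionReading_of_reading`): the chart points of
readings `v, w` at `s` near `s₁` ARE the values of the two sections chosen at `s₁`; and the unit `u` read along `τ` is a continuous `μ_M`-valued
function, hence locally constant (★ W3).  So the Weil pairing of the chart points of readings `v, w` is the same at `s` and at `s₁` for `s` near
`s₁` (`eventually_pairingReading_eq`), for ANY ample witnesses of `λ` ([Lang1983AbelianVarieties] VII §2 Prop. 3; ★ `IsLambdaOfAt.weilPairingLevel_eq`).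

## References
* [MumfordAV1970] D. Mumford, *Abelian Varieties* (1970), §20 (pp. 183–185).
* [BirkenhakeLange2004] C. Birkenhake, H. Lange, *Complex Abelian Varieties*, 2nd ed. (2004), Ch. 8 §8.7 Lemma 8.7.1 pp. 229–231.
* [DeligneHodgeII1971] P. Deligne, *Théorie de Hodge II*, Publ. Math. IHÉS 40 (1971), §4.4 (4.4.2)–(4.4.3) pp. 50–51.
* [MumfordFogartyKirwan1994] D. Mumford, J. Fogarty, F. Kirwan, *Geometric Invariant Theory*, 3rd ed. (1994), Ch. 7 §2 Prop. 7.3 (pp. 133–134).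
-/

set_option autoImplicit false

noncomputable section

universe u

open CategoryTheory CategoryTheory.Limits AlgebraicGeometry Topology Set Function Filter
open scoped Manifold MonObj
open Literature.AlgebraicGeometry.Motives (SchemeOver ComplexPoints AlgPoints specOver AbelianVariety CartierDivisor)
open Literature.AlgebraicGeometry.AbelianSchemes (PolarizedAbelianSchemeWithLevel AbelianSchemeOver)
open Literature.Geometry.Kaehler (ComplexTorus)
open Literature.Geometry.Kaehler.ComplexTorus (cover proj)
open Literature.Geometry.ComplexAnalytic (IsRelExpChartOn totalOver projOver basePoint)
open Literature.NumberTheory.Transcendental (IsAnalytification)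

namespace Literature.AlgebraicGeometry.ModuliOfAbelianVarieties

namespace RelativeExponentialChartPairingReadings

variable {g d : ℕ} {T : SchemeOver ℂ}
  {MT : Type} [TopologicalSpace MT] [ChartedSpace (Fin d → ℂ) MT] {φT : MT → ComplexPoints T}
  {MA : Type} [TopologicalSpace MA] [ChartedSpace (Fin (d + g) → ℂ) MA]

/-! ### §0 Plumbing -/

/-- Powers of an additive map from the torus: `φ (m • τ) = (φ τ) ^ m` (plumbing). [folklore] -/
private theorem map_nsmul_eq_pow {Φ : (Fin g ⊕ Fin g → ℝ) ≃L[ℝ] (Fin g → ℂ)} {G : Type*} [Group G]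
    (φ : ComplexTorus Φ → G) (hadd : ∀ x y, φ (x + y) = φ x * φ y) (τ : ComplexTorus Φ) (m : ℕ) : φ (m • τ) = φ τ ^ m := by
  have h0 : φ 0 = 1 := by
    have h := hadd 0 0
    rw [add_zero] at h
    exact (mul_eq_left.1 h.symm)
  induction m with
  | zero => simp [h0]
  | succ k ih => rw [succ_nsmul, hadd, ih, pow_succ]

/-- An element of the real torus killed by `m` lifts to an `m`-division vector (plumbing). [folklore] -/
private theorem exists_isDiv_of_nsmul_eq_zero {Φ : (Fin g ⊕ Fin g → ℝ) ≃L[ℝ] (Fin g → ℂ)} {τ : ComplexTorus Φ} {m : ℕ}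
    (hτ : m • τ = 0) : ∃ x : Fin g ⊕ Fin g → ℝ, (∀ i, ∃ k : ℤ, (m : ℝ) * x i = k) ∧ proj Φ x = τ := by
  refine ⟨ComplexTorus.lift Φ τ, fun i => ?_, ComplexTorus.proj_lift Φ τ⟩
  have hi : m • ((τ : (Fin g ⊕ Fin g) → AddCircle (1 : ℝ)) i) = 0 :=
    congrArg (fun f : ComplexTorus Φ => (f : (Fin g ⊕ Fin g) → AddCircle (1 : ℝ)) i) hτ
  have hlift : ((ComplexTorus.lift Φ τ i : ℝ) : AddCircle (1 : ℝ)) = (τ : (Fin g ⊕ Fin g) → AddCircle (1 : ℝ)) i := by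
    have := congrArg (fun f : ComplexTorus Φ => (f : (Fin g ⊕ Fin g) → AddCircle (1 : ℝ)) i) (ComplexTorus.proj_lift Φ τ)
    simpa only [ComplexTorus.proj_apply] using this
  have h2 : ((((m : ℝ) * ComplexTorus.lift Φ τ i : ℝ)) : AddCircle (1 : ℝ)) = 0 := by
    rw [← nsmul_eq_mul, AddCircle.coe_nsmul, hlift]
    exact hi
  obtain ⟨k, hk⟩ := (AddCircle.coe_eq_zero_iff (1 : ℝ)).1 h2
  exact ⟨k, by rw [← hk, zsmul_eq_mul, mul_one]⟩

omit [TopologicalSpace MT] [ChartedSpace (Fin d → ℂ) MT] in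
/-- **The chart reading of an `M`-torsion fibre point is an `M`-division vector**, through an additive fibre analytification (G) (plumbing):
if `Q ∈ A_s(ℂ)`, `Q^M = 1`, then `Q` is the chart point `ex₁ (s, Φ₁ s x̃)` for an `M`-division vector `x̃`. [folklore] -/
private theorem exists_isDiv_reading_of_pow_eq_one (A : AbelianSchemeOver T.left) (φA : MA → ComplexPoints (totalOver T A))
    (hA : IsAnalytification (Fin (d + g) → ℂ) (totalOver T A) (d + g) φA)
    {Φ₁ : MT → ((Fin g ⊕ Fin g → ℝ) ≃L[ℝ] (Fin g → ℂ))} {ex₁ : MT × (Fin g → ℂ) → MA} {s : MT}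
    (hGs : ∃ φt : ComplexTorus (Φ₁ s) → (A.fibre (φT s).left).toAbelianVariety.Points ℂ,
      IsAnalytification (Fin g → ℂ) (A.fibre (φT s).left).toAbelianVariety.X g φt ∧
      (∀ x y, φt (x + y) = φt x * φt y) ∧
      ∀ z : Fin g → ℂ, (φA (ex₁ (s, z))).left = A.fibrePointToLeft (φT s).left (φt (cover (Φ₁ s) z)))
    {m : ℕ} (Q : (A.fibre (φT s).left).toAbelianVariety.Points ℂ) (hQ : Q ^ m = 1) {a : MA}
    (ha : (φA a).left = A.fibrePointToLeft (φT s).left Q) :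
    ∃ x : Fin g ⊕ Fin g → ℝ, (∀ i, ∃ k : ℤ, (m : ℝ) * x i = k) ∧ a = ex₁ (s, Φ₁ s x) := by
  obtain ⟨φt, hφt, hadd, hcomp⟩ := hGs
  obtain ⟨τ, hτ⟩ := hφt.isHomeomorph.surjective Q
  have h1 : φt 0 = 1 := by
    have := map_nsmul_eq_pow φt hadd 0 0
    rwa [zero_nsmul, pow_zero] at this
  have hτm : m • τ = 0 := by
    apply hφt.isHomeomorph.injective
    rw [map_nsmul_eq_pow φt hadd τ m, hτ, h1]
    exact hQ
  obtain ⟨x, hxdiv, hxτ⟩ := exists_isDiv_of_nsmul_eq_zero hτm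
  refine ⟨x, hxdiv, hA.isHomeomorph.injective (Over.OverMorphism.ext ?_)⟩
  rw [hcomp, ComplexTorus.cover_apply_apply, hxτ, hτ]
  exact ha

/-- `M ≠ 0` in the residue fields of a scheme over a field of characteristic zero (plumbing). [folklore] -/
private theorem natCast_residueField_ne_zero_of_charZero {K : Type u} [Field K] [CharZero K] {S : Scheme.{u}} (f : S ⟶ Spec (.of K))
    (s : S) {N : ℕ} (hN : N ≠ 0) : (N : S.residueField s) ≠ 0 := by
  let φ : K →+* S.residueField s := (Spec.preimage (S.fromSpecResidueField s ≫ f)).hom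
  rw [← map_natCast φ N]
  exact (map_ne_zero φ).mpr (Nat.cast_ne_zero.mpr hN)

/-! ### §1 The fibre value of a torsion section of `A_B` at a complex point of `B`, read in `A`, and its identification -/

section Engine

variable (P' : AbelianSchemeOver T.left) {B : Scheme.{0}} (b : B ⟶ T.left) {M : ℕ}

/-- The point of `A` under the value of a section `x` of `A_B` at `t′ : Spec ℂ → B`: `fibrePointToLeft (t′ ≫ b) (x(t′)) = t′ ≫ x ≫ pr_A` (plumbing over ★
`coe_baseChangeTorsionPt`, ★ `fibrePointToLeft_map_fibreBaseChangeIso_hom`, ★ `restrictPt_left_fst`). [folklore] -/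
private theorem fibrePointToLeft_baseChangeTorsionPt [IsCommMonObj (P'.baseChange b).X] (t' : Spec (.of ℂ) ⟶ B)
    (x : (P'.baseChange b).torsionSections M) :
    P'.fibrePointToLeft (t' ≫ b) ((P'.baseChangeTorsionPt M b t' x :
        (P'.fibre (t' ≫ b)).toAbelianVariety.torsionPoints ℂ (M : ℤ)) : (P'.fibre (t' ≫ b)).toAbelianVariety.Points ℂ) =
      t' ≫ (x : (P'.baseChange b).Sections).left ≫ pullback.fst P'.X.hom b := by
  rw [AbelianSchemeOver.coe_baseChangeTorsionPt, AbelianSchemeOver.fibrePointsMulEquiv_apply,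
    AbelianSchemeOver.fibrePointToLeft_map_fibreBaseChangeIso_hom]
  have h : (P'.baseChange b).fibrePointToLeft t' ((P'.baseChange b).restrictPt t' (x : (P'.baseChange b).Sections)) =
      t' ≫ (x : (P'.baseChange b).Sections).left := by
    change ((P'.baseChange b).restrictPt t' (x : (P'.baseChange b).Sections)).left ≫ pullback.fst _ _ = _
    exact (P'.baseChange b).restrictPt_left_fst t' _
  rw [h, Category.assoc]

end Engine

/-! ### §2 THE LOCAL HEAD -/

/-- **FLAT-b(ii), LOCAL FORM — THE WEIL-PAIRING READINGS OF THE CHART FRAME ARE LOCALLY CONSTANT** ([MumfordAV1970] §20; [BirkenhakeLange2004] §8.7 Lemma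
8.7.1; [DeligneHodgeII1971] (4.4.2)–(4.4.3)): polarised abelian scheme `P` with level structure over a smooth separated complex base `T` (`P.A` of
relative dimension `g`), analytifications `φT`, `φA`, a relative exponential chart `(Φ₁, ex₁)` of `(P.A)^an → T^an` over an open `V` with additive
fibre analytifications (G) on `V`, `s₁ ∈ V`, `M` with `(M : ℂ) ≠ 0`, rational vectors `v, w`, torsion points `P₁, Q₁ ∈ A_{s₁}[M]` which are the
chart points of readings `v, w` at `s₁`, and a witness `Θ₁` of `λ` at `s₁`.  THEN for all `s ∈ V` near `s₁`, every witness `Θ` of `λ` at `s` and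
all torsion points `Pt, Qt ∈ A_s[M]` which are the chart points of readings `v, w` at `s`: `ē^Θ_M(Pt, Qt) = ē^{Θ₁}_M(P₁, Q₁)`.
[cite: MumfordAV1970, §20 (pp. 183–185)] [cite: BirkenhakeLange2004, §8.7 Lemma 8.7.1] [cite: DeligneHodgeII1971, §4.4 (4.4.2)–(4.4.3) pp. 50–51] -/
theorem eventually_pairingReading_eq {N : ℕ} {δ : Fin g → ℕ} [IsSeparated T.hom] [SmoothOfRelativeDimension d T.hom]
    (P : PolarizedAbelianSchemeWithLevel g N δ T.left)
    (hT : IsAnalytification (Fin d → ℂ) T d φT)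
    (φA : MA → ComplexPoints (totalOver T P.A)) (hA : IsAnalytification (Fin (d + g) → ℂ) (totalOver T P.A) (d + g) φA)
    {V : Set MT} {Φ₁ : MT → ((Fin g ⊕ Fin g → ℝ) ≃L[ℝ] (Fin g → ℂ))} {ex₁ : MT × (Fin g → ℂ) → MA}
    (hex₁ : IsRelExpChartOn (Fin d → ℂ) (Fin (d + g) → ℂ) (basePoint hT P.A φA) V Φ₁ ex₁)
    (hG : ∀ t ∈ V, ∃ φt : ComplexTorus (Φ₁ t) → (P.A.fibre (φT t).left).toAbelianVariety.Points ℂ,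
      IsAnalytification (Fin g → ℂ) (P.A.fibre (φT t).left).toAbelianVariety.X g φt ∧
      (∀ x y, φt (x + y) = φt x * φt y) ∧
      ∀ z : Fin g → ℂ, (φA (ex₁ (t, z))).left = P.A.fibrePointToLeft (φT t).left (φt (cover (Φ₁ t) z)))
    {s₁ : MT} (hs₁ : s₁ ∈ V) {M : ℕ} (hMΩ : (M : ℂ) ≠ 0) (v w : Fin g ⊕ Fin g → ℚ)
    (P₁ Q₁ : (P.A.fibre (φT s₁).left).toAbelianVariety.torsionPoints ℂ (M : ℤ))
    (hP₁ : P.A.fibrePointToLeft (φT s₁).left (P₁ : (P.A.fibre (φT s₁).left).toAbelianVariety.Points ℂ) =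
      (φA (ex₁ (s₁, Φ₁ s₁ (fun j => (v j : ℝ))))).left)
    (hQ₁ : P.A.fibrePointToLeft (φT s₁).left (Q₁ : (P.A.fibre (φT s₁).left).toAbelianVariety.Points ℂ) =
      (φA (ex₁ (s₁, Φ₁ s₁ (fun j => (w j : ℝ))))).left)
    (Θ₁ : CartierDivisor (P.A.fibre (φT s₁).left).toAbelianVariety.X.left) (hlam₁ : P.A.IsLambdaOfAt (φT s₁).left P.D P.pol.lam Θ₁) :
    ∀ᶠ s in 𝓝[V] s₁, ∀ (Θ : CartierDivisor (P.A.fibre (φT s).left).toAbelianVariety.X.left), P.A.IsLambdaOfAt (φT s).left P.D P.pol.lam Θ →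
      ∀ (Pt Qt : (P.A.fibre (φT s).left).toAbelianVariety.torsionPoints ℂ (M : ℤ)),
      P.A.fibrePointToLeft (φT s).left (Pt : (P.A.fibre (φT s).left).toAbelianVariety.Points ℂ) =
          (φA (ex₁ (s, Φ₁ s (fun j => (v j : ℝ))))).left →
      P.A.fibrePointToLeft (φT s).left (Qt : (P.A.fibre (φT s).left).toAbelianVariety.Points ℂ) =
          (φA (ex₁ (s, Φ₁ s (fun j => (w j : ℝ))))).left →
      haveI := AbelianVariety.isDominant_toSchemeHom_zsmul_of_ne_zero (P.A.fibre (φT s).left).toAbelianVariety hMΩ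
      haveI := AbelianVariety.isDominant_toSchemeHom_zsmul_of_ne_zero (P.A.fibre (φT s₁).left).toAbelianVariety hMΩ
      (P.A.fibre (φT s).left).toAbelianVariety.weilPairingLevel Θ Pt Qt =
        (P.A.fibre (φT s₁).left).toAbelianVariety.weilPairingLevel Θ₁ P₁ Q₁ := by
  classical
  -- §a the base: reduced, locally Noetherian, `M` invertible; the abelian scheme commutative
  have hM0 : M ≠ 0 := by
    rintro rfl
    exact hMΩ (by simp)
  haveI : NeZero M := ⟨hM0⟩
  haveI : Smooth T.hom := SmoothOfRelativeDimension.smooth d T.hom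
  haveI : IsReduced T.left := Literature.AlgebraicGeometry.Resolution.isReduced_of_smooth T.hom
  haveI : IsLocallyNoetherian T.left := LocallyOfFiniteType.isLocallyNoetherian T.hom
  haveI : IsCommMonObj P.A.X := P.A.isCommMonObj_of_isLocallyNoetherian_base
  haveI := P.pol.isMonHom
  have hQM : ∀ x : T.left, (M : T.left.residueField x) ≠ 0 := fun x => natCast_residueField_ne_zero_of_charZero T.hom x hM0
  -- §b a finite étale cover with a level-`M` structure ([MumfordFogartyKirwan1994] Prop. 7.3 (IV))
  obtain ⟨B, b, hfin, het, hsurj, ⟨ψ⟩, -⟩ := P.A.exists_finite_etale_surjective_levelStructure (M := M) P.relDim hQM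
  haveI := het
  haveI := hsurj
  haveI : IsLocallyNoetherian B := LocallyOfFiniteType.isLocallyNoetherian b
  haveI : IsCommMonObj (P.A.baseChange b).X := (P.A.baseChange b).isCommMonObj_of_isLocallyNoetherian_base
  -- §c the global pairing units ([MumfordAV1970] §20)
  obtain ⟨u, huM, hu⟩ := AbelianSchemeOver.exists_pairingUnits_weilPairingLevel_eq_inv P.A P.D P.hatNormalised P.pol.lam b M
  -- §d complex points of `B` and a local inverse of `b(ℂ)` at a point over `φT s₁`
  let Bℂ : SchemeOver ℂ := Over.mk (b ≫ T.hom)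
  let bOver : Bℂ ⟶ T := Over.homMk b rfl
  haveI : Etale bOver.left := het
  obtain ⟨b₁, hb₁⟩ := Literature.AlgebraicGeometry.Morphisms.exists_specOver_of_surjective b (φT s₁).left
  have hw₁ : b₁ ≫ Bℂ.hom = (specOver ℂ ℂ).hom := by
    change b₁ ≫ b ≫ T.hom = _
    rw [← Category.assoc, hb₁]
    exact Over.w (φT s₁)
  let p₁ : ComplexPoints Bℂ := Over.homMk b₁ hw₁
  have hmapleft : ∀ q : ComplexPoints Bℂ, (AlgPoints.map bOver q).left = q.left ≫ b := fun q => rfl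
  have hp₁ : AlgPoints.map bOver p₁ = φT s₁ := Over.OverMorphism.ext (by rw [hmapleft]; exact hb₁)
  obtain ⟨E, hpE, hEq⟩ := Literature.AlgebraicGeometry.FundamentalGroup.exists_openPartialHomeomorph_eqOn_map_of_etale bOver p₁
  have hτ : ∀ s, φT s ∈ E.target → AlgPoints.map bOver (E.symm (φT s)) = φT s := fun s hs => by
    rw [hEq (E.map_target hs)]
    exact E.right_inv hs
  have hτleft : ∀ s, φT s ∈ E.target → (E.symm (φT s)).left ≫ b = (φT s).left := fun s hs => by
    rw [← hmapleft, hτ s hs]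
  have hs₁E : φT s₁ ∈ E.target := by
    rw [← hp₁, hEq hpE]
    exact E.map_source hpE
  have hτ₁ : E.symm (φT s₁) = p₁ := by
    rw [← hp₁, hEq hpE, E.left_inv hpE]
  have hτc : ContinuousAt (fun s => E.symm (φT s)) s₁ :=
    (E.continuousOn_symm.continuousAt (E.open_target.mem_nhds hs₁E)).comp hT.isHomeomorph.continuous.continuousAt
  -- §e a torsion section `x` of `A_B` gives a continuous section `S x` of `A^an → T^an` near `s₁`, through `τ := E⁻¹ ∘ φT`
  have hx1 : ∀ x : (P.A.baseChange b).torsionSections M, (x : (P.A.baseChange b).Sections).left ≫ pullback.snd P.A.X.hom b = 𝟙 B := by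
    intro x
    have := Over.w (x : (P.A.baseChange b).Sections)
    erw [this]
    rfl
  have hxfst : ∀ x : (P.A.baseChange b).torsionSections M,
      ((x : (P.A.baseChange b).Sections).left ≫ pullback.fst P.A.X.hom b) ≫ P.A.X.hom = b := by
    intro x
    erw [Category.assoc, pullback.condition, ← Category.assoc, hx1 x, Category.id_comp]
  have hsecw : ∀ x : (P.A.baseChange b).torsionSections M,
      ((x : (P.A.baseChange b).Sections).left ≫ pullback.fst P.A.X.hom b) ≫ (totalOver T P.A).hom = Bℂ.hom := by
    intro x
    change ((x : (P.A.baseChange b).Sections).left ≫ pullback.fst P.A.X.hom b) ≫ P.A.X.hom ≫ T.hom = b ≫ T.hom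
    erw [← Category.assoc, hxfst x]
    rfl
  let secHom : (P.A.baseChange b).torsionSections M → (Bℂ ⟶ totalOver T P.A) := fun x =>
    Over.homMk (((x : (P.A.baseChange b).Sections).left ≫ pullback.fst P.A.X.hom b)) (hsecw x)
  let S : (P.A.baseChange b).torsionSections M → MT → MA := fun x s => hA.homeomorph.symm (AlgPoints.map (secHom x) (E.symm (φT s)))
  have hS : ∀ x s, φA (S x s) = AlgPoints.map (secHom x) (E.symm (φT s)) := fun x s => by
    change hA.homeomorph (hA.homeomorph.symm _) = _
    exact hA.homeomorph.apply_symm_apply _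
  have hSleft : ∀ x s, (φA (S x s)).left = (E.symm (φT s)).left ≫ (x : (P.A.baseChange b).Sections).left ≫ pullback.fst P.A.X.hom b :=
    fun x s => by rw [hS]; rfl
  have hSc : ∀ x, ContinuousAt (S x) s₁ := fun x =>
    hA.homeomorph.symm.continuous.continuousAt.comp ((AlgPoints.continuous_map (secHom x)).continuousAt.comp hτc)
  have hSbase : ∀ x s, φT s ∈ E.target → basePoint hT P.A φA (S x s) = s := fun x s hs => by
    apply hT.homeomorph.injective
    rw [IsAnalytification.coe_homeomorph, Literature.Geometry.ComplexAnalytic.apply_basePoint hT P.A φA (S x s), hS,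
      ← AlgPoints.map_comp_apply]
    have hcomp : secHom x ≫ projOver T P.A = bOver := by
      ext : 1
      exact hxfst x
    rw [hcomp, hτ s hs]
  -- §f the fibre value of `x` at a complex point `q` of `B`, as a torsion point of the fibre over ANY `σ = q ≫ b` (transport in `σ`)
  have hval : ∀ (q : Spec (.of ℂ) ⟶ B) (σ : Spec (.of ℂ) ⟶ T.left), q ≫ b = σ → ∀ x : (P.A.baseChange b).torsionSections M,
      ∃ Q : (P.A.fibre σ).toAbelianVariety.torsionPoints ℂ (M : ℤ),
        P.A.fibrePointToLeft σ (Q : (P.A.fibre σ).toAbelianVariety.Points ℂ) =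
          q ≫ (x : (P.A.baseChange b).Sections).left ≫ pullback.fst P.A.X.hom b ∧
        ∀ (Θ : CartierDivisor (P.A.fibre σ).toAbelianVariety.X.left), P.A.IsLambdaOfAt σ P.D P.pol.lam Θ →
          ∀ (y : (P.A.baseChange b).torsionSections M) (R : (P.A.fibre σ).toAbelianVariety.torsionPoints ℂ (M : ℤ)),
            P.A.fibrePointToLeft σ (R : (P.A.fibre σ).toAbelianVariety.Points ℂ) =
              q ≫ (y : (P.A.baseChange b).Sections).left ≫ pullback.fst P.A.X.hom b →
            haveI := AbelianVariety.isDominant_toSchemeHom_zsmul_of_ne_zero (P.A.fibre σ).toAbelianVariety hMΩ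
            (P.A.fibre σ).toAbelianVariety.weilPairingLevel Θ Q R = ((Scheme.ΓSpecIso (.of ℂ)).hom (q.appTop (u y x)))⁻¹ := by
    rintro q σ rfl x
    refine ⟨P.A.baseChangeTorsionPt M b q x, fibrePointToLeft_baseChangeTorsionPt P.A b q x, fun Θ hΘ y R hR => ?_⟩
    have hRy : R = P.A.baseChangeTorsionPt M b q y :=
      Subtype.ext (P.A.fibrePointToLeft_injective _ (hR.trans (fibrePointToLeft_baseChangeTorsionPt P.A b q y).symm))
    rw [hRy]
    exact hu q hMΩ Θ hΘ x y
  -- §g sections `xa`, `xb` through `P₁`, `Q₁` (every torsion point of the fibre at `b₁ ≫ b = φT s₁` is a section value)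
  have hsurjsec : ∀ (σ : Spec (.of ℂ) ⟶ T.left), b₁ ≫ b = σ → ∀ R : (P.A.fibre σ).toAbelianVariety.torsionPoints ℂ (M : ℤ),
      ∃ x : (P.A.baseChange b).torsionSections M, P.A.fibrePointToLeft σ (R : (P.A.fibre σ).toAbelianVariety.Points ℂ) =
        b₁ ≫ (x : (P.A.baseChange b).Sections).left ≫ pullback.fst P.A.X.hom b := by
    rintro σ rfl R
    have hR : (R : (P.A.fibre (b₁ ≫ b)).toAbelianVariety.Points ℂ) ^ M = 1 := by
      rw [← zpow_natCast]
      exact (AbelianVariety.mem_torsionPoints_iff _ _).1 R.2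
    have hR' : (P.A.fibrePointsMulEquiv b b₁).symm (R : (P.A.fibre (b₁ ≫ b)).toAbelianVariety.Points ℂ) ^ M = 1 := by
      rw [← map_pow, hR, map_one]
    obtain ⟨a, ha⟩ := ψ.exists_restrictPt_section_eq b₁ _ hR'
    have hmem : ψ.section_ a ∈ (P.A.baseChange b).torsionSections M :=
      ((P.A.baseChange b).mem_torsionSections_iff M _).2 ((P.A.baseChange b).sectionPow_pow_eq_one ψ.pow_σ a)
    refine ⟨⟨ψ.section_ a, hmem⟩, ?_⟩
    rw [← fibrePointToLeft_baseChangeTorsionPt P.A b b₁ ⟨ψ.section_ a, hmem⟩, AbelianSchemeOver.coe_baseChangeTorsionPt]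
    change _ = P.A.fibrePointToLeft (b₁ ≫ b) (P.A.fibrePointsMulEquiv b b₁ ((P.A.baseChange b).restrictPt b₁ (ψ.section_ a)))
    rw [ha, MulEquiv.apply_symm_apply]
  obtain ⟨xa, hxa⟩ := hsurjsec _ hb₁ P₁
  obtain ⟨xb, hxb⟩ := hsurjsec _ hb₁ Q₁
  -- §h at `s₁` the sections `S xa`, `S xb` ARE the chart points of readings `v`, `w`
  have hp₁left : (E.symm (φT s₁)).left = b₁ := by rw [hτ₁]; rfl
  have hSread : ∀ (x : (P.A.baseChange b).torsionSections M) (R : (P.A.fibre (φT s₁).left).toAbelianVariety.torsionPoints ℂ (M : ℤ))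
      (r : Fin g ⊕ Fin g → ℚ),
      P.A.fibrePointToLeft (φT s₁).left (R : (P.A.fibre (φT s₁).left).toAbelianVariety.Points ℂ) =
        b₁ ≫ (x : (P.A.baseChange b).Sections).left ≫ pullback.fst P.A.X.hom b →
      P.A.fibrePointToLeft (φT s₁).left (R : (P.A.fibre (φT s₁).left).toAbelianVariety.Points ℂ) =
        (φA (ex₁ (s₁, Φ₁ s₁ (fun j => (r j : ℝ))))).left → S x s₁ = ex₁ (s₁, Φ₁ s₁ (fun j => (r j : ℝ))) := by
    intro x R r h1 h2
    apply hA.isHomeomorph.injective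
    apply Over.OverMorphism.ext
    rw [hSleft, hp₁left]
    exact h1.symm.trans h2
  have hSa₁ : S xa s₁ = ex₁ (s₁, Φ₁ s₁ (fun j => (v j : ℝ))) := hSread xa P₁ v hxa hP₁
  have hSb₁ : S xb s₁ = ex₁ (s₁, Φ₁ s₁ (fun j => (w j : ℝ))) := hSread xb Q₁ w hxb hQ₁
  -- §i on `V' := V ∩ φT⁻¹(E.target)` the sections read `M`-division vectors, hence KEEP their readings near `s₁` (★ W1)
  set V' : Set MT := V ∩ φT ⁻¹' E.target with hV'
  have hV'U : V' ⊆ V := inter_subset_left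
  have hs₁V' : s₁ ∈ V' := ⟨hs₁, hs₁E⟩
  have hO : φT ⁻¹' E.target ∈ 𝓝[V] s₁ :=
    mem_nhdsWithin_of_mem_nhds ((E.open_target.preimage hT.isHomeomorph.continuous).mem_nhds hs₁E)
  have hdiv : ∀ x : (P.A.baseChange b).torsionSections M, ∀ s ∈ V', ∃ r : Fin g ⊕ Fin g → ℝ, (∀ i, ∃ k : ℤ, (M : ℝ) * r i = k) ∧ S x s = ex₁ (s, Φ₁ s r) := by
    intro x s hs
    obtain ⟨Q, hQ, -⟩ := hval _ _ (hτleft s hs.2) x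
    have hQM : (Q : (P.A.fibre (φT s).left).toAbelianVariety.Points ℂ) ^ M = 1 := by
      rw [← zpow_natCast]
      exact (AbelianVariety.mem_torsionPoints_iff _ _).1 Q.2
    exact exists_isDiv_reading_of_pow_eq_one P.A φA hA (hG s hs.1) _ hQM ((hSleft x s).trans hQ.symm)
  have hread : ∀ (x : (P.A.baseChange b).torsionSections M) (r : Fin g ⊕ Fin g → ℝ), S x s₁ = ex₁ (s₁, Φ₁ s₁ r) → ∀ᶠ s in 𝓝[V] s₁, S x s = ex₁ (s, Φ₁ s r) := by
    intro x r hr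
    have h := hex₁.eventually_sectionReading_of_reading hV'U (fun s hs => hSbase x s hs.2) hM0 (hdiv x) hs₁V'
      ((hSc x).continuousWithinAt) hr
    rw [hV', nhdsWithin_inter_of_mem' hO] at h
    exact h
  -- §j the unit `u xb xa` read along `τ` is locally constant (★ W3)
  have hunit := Literature.AlgebraicGeometry.Motives.AlgPoints.eventually_nhdsWithin_appTop_comp_eq_of_pow_eq_one (X := Bℂ)
    (u xb xa) hM0 (huM xa xb) (s := V) hτc.continuousWithinAt
  -- §k assemble
  filter_upwards [hread xa _ hSa₁, hread xb _ hSb₁, hunit, hO, self_mem_nhdsWithin] with s hra hrb hus hsE hsV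
  intro Θ hΘ Pt Qt hPt hQt
  -- at `s`: `Pt`, `Qt` are the values of `xa`, `xb` at `E⁻¹ (φT s)`, so the pairing is the inverse unit value there
  obtain ⟨Qa, hQa, hpair⟩ := hval _ _ (hτleft s hsE) xa
  have hPt' : P.A.fibrePointToLeft (φT s).left (Pt : (P.A.fibre (φT s).left).toAbelianVariety.Points ℂ) =
      (E.symm (φT s)).left ≫ (xa : (P.A.baseChange b).Sections).left ≫ pullback.fst P.A.X.hom b := by
    rw [hPt, ← hra, hSleft]
  have hQt' : P.A.fibrePointToLeft (φT s).left (Qt : (P.A.fibre (φT s).left).toAbelianVariety.Points ℂ) =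
      (E.symm (φT s)).left ≫ (xb : (P.A.baseChange b).Sections).left ≫ pullback.fst P.A.X.hom b := by
    rw [hQt, ← hrb, hSleft]
  have hPtQa : Pt = Qa := Subtype.ext (P.A.fibrePointToLeft_injective _ (hPt'.trans hQa.symm))
  have h_s := hpair Θ hΘ xb Qt hQt'
  rw [← hPtQa] at h_s
  -- at `s₁`: likewise with `P₁`, `Q₁`, `Θ₁`
  obtain ⟨Qa₁, hQa₁, hpair₁⟩ := hval _ _ hb₁ xa
  have hP₁Qa : P₁ = Qa₁ := Subtype.ext (P.A.fibrePointToLeft_injective _ (hxa.trans hQa₁.symm))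
  have h_s₁ := hpair₁ Θ₁ hlam₁ xb Q₁ hxb
  rw [← hP₁Qa] at h_s₁
  rw [h_s, h_s₁, ← hp₁left]
  exact congrArg (·⁻¹) hus

end RelativeExponentialChartPairingReadings

end Literature.AlgebraicGeometry.ModuliOfAbelianVarieties

end
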